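import Summits.KontsevichZagierPeriods.KontsevichZagierPeriods.Theses.HardSphereVirial

/-!
# `VolumeFormOfKernel` (stmt-KontsevichZagierPeriods-14473, route HardSphereVirial) — candidate proof

The glue of route HardSphereVirial: instantiate `R := KZ.relations` in `UnitDistanceKernel`.
-/

namespace Summit.KontsevichZagierPeriods.HardSphereVirial

open Summit.KontsevichZagierPeriods.KontsevichZagierPeriods.Theses.HardSphereVirial

/-- **Glue** (route HardSphereVirial, `VolumeFormOfKernel`, stmt-KontsevichZagierPeriods-14473): the kernel crux and the three
relator cruxes give the target `VolumeForm` (instantiate `R := KZ.relations`). [cite: KontsevichZagier2001, §1.2] -/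
theorem volumeFormOfKernel_proof :
    Summit.KontsevichZagierPeriods.KontsevichZagierPeriods.Theses.HardSphereVirial.VolumeFormOfKernel :=
  fun hK h2 h4 h5 _N r r' hr hr' hv =>
    hK Literature.NumberTheory.Transcendental.KZ.relations le_rfl h2 h4 h5 r r' hr hr' hv

end Summit.KontsevichZagierPeriods.HardSphereVirial
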